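import Literature.NumberTheory.EllipticCurves.CyclotomicIwasawaMainTheoremIrreducibleBaseChangeProofs
import Literature.NumberTheory.EllipticCurves.GaloisAction
import Literature.NumberTheory.EllipticCurves.TwoVariableSelmerDual
import Literature.NumberTheory.EllipticCurves.YanZhu2026.TwoVariableMainTheorems
import Literature.NumberTheory.EllipticCurves.YanZhu2026.GreenbergMainTheorems
import Literature.NumberTheory.EllipticCurves.YanZhu2026.GreenbergMainTheoremsAnyRoot
import Literature.NumberTheory.EllipticCurves.PAdicBSD
import Literature.NumberTheory.EllipticCurves.PAdicLFunction
import Literature.NumberTheory.EllipticCurves.HeegnerPoints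
import Literature.NumberTheory.Automorphic.BCDTModularity
import HarnessLib

/-!
# Route `TwoAdicConverse` (rung S3), crux `OrdLambdaHalfAtTwo` (item stmt-BirchSwinnertonDyer-19556), line
# `xi_dominant_klingen_two` (habitat S₃): the line's posited INTERFACE `XiDatum` (and its frame record) as Theorems-side
# definitions, so that the supply stub `stub_supplyAtTwo : … → Nonempty (XiDatum W κ γ)` can be stated and proved in a
# Theorems file (a Theorems file cannot import `Cruxes/`)

Cell `bsd-2adic`, seat `bsd-2adic-conv-1` GEN 27 (definition lane; `--supports` stmt-BirchSwinnertonDyer-19556).  Pattern of the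
cell's binder files (`…OrdLambdaHalfAtTwoKatoDeterminantDefs.lean`, `…OffBigImageOddLocalDefs.lean`): the checked, published
(unregistered, pen RC-313) skeleton `Cruxes/OrdLambdaHalfAtTwo/Lines/xi_dominant_klingen_two.lean` §1 declares these two
structures in-file; they are transcribed here VERBATIM (field names, types and order unchanged; namespace
`…Theorems.TwoAdicXiSupply` instead of `…Cruxes.OrdLambdaHalfAtTwo.XiDominantKlingenTwo`), so that the (α) lead can replace
§1 by `import` and close `stub_supplyAtTwo` by the companion theorem `TwoAdicXiSupply.nonempty_xiDatum`.

* `XiDatum W κ γ` — the `ξ`-dominant datum of `W` at `2` relative to the crux's cyclotomic normalisation `(κ, γ)` of `ℚ`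
  (an imaginary quadratic `K` with `2` split, embedding data, TWO generator pairs of `Gal(K̃_∞/K) ≅ ℤ₂²` — the «2-adic pair
  phenomenon», see `TwoAdicConverseOrdLambdaHalfAtTwoXiGeneratorPairs.lean` — (irr_K), (spl), twist-ordinarity).  A
  Type-valued interface: NO existence is smuggled (existence is the theorem `nonempty_xiDatum`).
* `XiDatum.GreenbergFrame` — the record of tree predicates «`LK` IS the Katz measure, `G` IS the Greenberg `L`-function»
  over pair′, consumed by the line's research stubs W2 / P1 / BF2 (no existence smuggled: frames are produced by W2).

HONEST FRAMING.  Definitions only (no theorem, no named fact, no instance beyond the structure-field projections); nothing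
about any curve is asserted; the crux is NOT proved; BSD is not proved by any of this.  PARTITION (D-0054): none — RANK
axis S3 × X5@2 stratum S₃.

References: BSTW arXiv:2409.01350v2 §9.4 [BurungaleSkinnerTianWan2024]; X. Wan, Algebra Number Theory 14 (2020)
[Wan2020ANT]; Yan–Zhu, J. Algebra 693 (2026) §2–3 [YanZhu2026]; Greenberg, LNM 1716 (1999) §1 [GreenbergLNM1716].
-/

-- D-0017: single-problem summit, the namespace repeats the problem name by design.
set_option linter.dupNamespace false
set_option autoImplicit false

noncomputable section

open scoped MatrixGroups ModularForm
open CongruenceSubgroup WeierstrassCurve NumberField IsDedekindDomain Field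
open Literature.NumberTheory.EllipticCurves Literature.NumberTheory.GaloisRepresentations

namespace Summit.BirchSwinnertonDyer.BirchSwinnertonDyer.Theorems.TwoAdicXiSupply

/-- **The `ξ`-dominant datum of `W` at `2`** relative to the crux's cyclotomic normalisation `(κ, γ)` of `ℚ`:
an imaginary quadratic `K` with `2 = v v̄` split, `(N_E, d_K) = 1`, `ρ̄_{E,2}|_{G_K}` absolutely irreducible, a prime of
`N_E` NOT split in `K` (BSTW (spl)), embedding data `ι : ℚ̄₂ ≃ ℂ` (inducing `v`), `ι₁`, a structure map
`J : ℤ₂ → 𝒪_{ℂ₂}`, and the TWO generator pairs of the 2-adic pair phenomenon (module docstring): `pair = (κ₁ = κ_cyc,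
κ₂; γ₁, γ₂)` restricting to `(κ, γ)` on `ℚ`, and `pair′ = (κ₁′, κ₂′ = κ_ac; γ₁′, γ₂′)`.  `= GreenbergSetting` of
Yan–Zhu minus `three_le` / `anticyclotomic` / `discr_odd` / `discr_ne` (BDP-only fields), plus the habitat fields.
A Type-valued interface: NO existence is smuggled (that is `stub_supplyAtTwo`, proved as `nonempty_xiDatum`).  VERBATIM the
structure of `Cruxes/OrdLambdaHalfAtTwo/Lines/xi_dominant_klingen_two.lean` §1. [cite: BurungaleSkinnerTianWan2024, §9.4] -/
structure XiDatum (W : WeierstrassCurve ℚ) [W.IsElliptic] [W.IsGloballyMinimal]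
    (κ : ZpExtension ℚ 2) (γ : absoluteGaloisGroup ℚ) : Type 1 where
  /-- The imaginary quadratic field. -/
  K : Type
  [field : Field K]
  [numberField : NumberField K]
  [discrNeZero : NeZero (NumberField.discr K).natAbs]
  /-- Embedding datum `ℚ̄₂ ≃ ℂ`. -/
  ι : PadicAlgCl 2 ≃+* ℂ
  /-- `ι₁ : ℤ̄ → ℂ₂` compatible with `ι`. -/
  ι₁ : integralClosure ℚ ℂ →+* ℂ_[2]
  ι₁_compat : ∀ z : integralClosure ℚ ℂ, ι₁ z = ((ι.symm (z : ℂ) : PadicAlgCl 2) : ℂ_[2])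
  /-- Structure map `ℤ₂ → 𝒪_{ℂ₂}` (reading `Λ_K ⊂ Λ_K^{ur} ⊂ 𝒪_{ℂ₂}⟦T₁,T₂⟧`). -/
  J : ℤ_[2] →+* PadicComplexInt 2
  J_compat : ∀ x : ℤ_[2], ((J x : PadicComplexInt 2) : ℂ_[2]) = ((x : ℚ_[2]) : ℂ_[2])
  /-- The two primes above `2`. -/
  v : HeightOneSpectrum (𝓞 K)
  vbar : HeightOneSpectrum (𝓞 K)
  /-- pair: cyclotomic-adapted. -/
  κ₁ : ZpExtension K 2
  κ₂ : ZpExtension K 2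
  γ₁ : absoluteGaloisGroup K
  γ₂ : absoluteGaloisGroup K
  [pair : Fact (ZpExtension.IsTopGeneratorPair κ₁ κ₂ γ₁ γ₂)]
  /-- pair′: anticyclotomic-adapted. -/
  κ₁' : ZpExtension K 2
  κ₂' : ZpExtension K 2
  γ₁' : absoluteGaloisGroup K
  γ₂' : absoluteGaloisGroup K
  [pair' : Fact (ZpExtension.IsTopGeneratorPair κ₁' κ₂' γ₁' γ₂')]
  isImaginaryQuadratic : IsImaginaryQuadratic K
  split : ((Ideal.span {(2 : ℤ)}).primesOver (𝓞 K)).ncard = 2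
  mem_v : ((2 : ℕ) : 𝓞 K) ∈ v.asIdeal
  mem_vbar : ((2 : ℕ) : 𝓞 K) ∈ vbar.asIdeal
  vbar_ne : vbar ≠ v
  compat : ∀ (w : InfinitePlace K) (k : 𝓞 K), k ∈ v.asIdeal ↔ ‖ι.symm (w.embedding (k : K))‖ < 1
  coprime : IsCoprime (W.conductorNorm ℤ : ℤ) (NumberField.discr K)
  /-- (irr_K): `ρ̄_{E,2}|_{G_K}` absolutely irreducible (from surjectivity and `K ≠ ℚ(√Δ_E)`). -/
  absIrr : ∀ ρ : ModPGaloisRep K (ZMod 2) 2, (W.baseChange K).IsTorsionGaloisRep 2 ρ →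
    FramedRep.IsAbsolutelyIrreducible ρ
  /-- (spl): some prime of the conductor does not split in `K`. -/
  exists_nonsplit : ∃ q : ℕ, q.Prime ∧ (q : ℤ) ∣ W.conductorNorm ℤ ∧
    ((Ideal.span {(q : ℤ)}).primesOver (𝓞 K)).ncard ≠ 2
  cyclotomic : κ₁.IsCyclotomic
  anticyclotomic : κ₂'.IsAnticyclotomic
  /-- `γ₁` restricts to the crux's generator `γ` of `Gal(ℚ_∞/ℚ)` (same normalisation). -/
  restrict_topGenerator : κ.IsTopGenerator (absGaloisRestrict ℚ K γ₁)
  restrict_cyclotomicVariable : IsCyclotomicVariable 2 (absGaloisRestrict ℚ K γ₁)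
  /-- Every minimal model of the twist `E^K = E^{(d_K)}` is good ordinary at `2` (`2` split in `K`). -/
  twist_ordinary : ∀ (A : WeierstrassCurve ℚ) [A.IsElliptic] [A.IsGloballyMinimal] (C : VariableChange ℚ),
    C • A = W.quadraticTwist ((NumberField.discr K : ℤ) : ℚ) → IsOrdinaryAt A 2

attribute [instance] XiDatum.field XiDatum.numberField XiDatum.discrNeZero XiDatum.pair XiDatum.pair'

variable {W : WeierstrassCurve ℚ} [W.IsElliptic] [W.IsGloballyMinimal] {κ : ZpExtension ℚ 2}
  {γ : absoluteGaloisGroup ℚ}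

/-- **A Katz / Greenberg frame pair at `2` over pair′** (the tree's reduction-type-free frames, `p = 2`), WITH
its period data: `LK` IS `𝓛_v(K)` (`IsKatzMeasure₂`, periods `Ω ≠ 0`, `δ² = ±d_K`, `Ω₂ ∈ W^×`) and `G` IS
`𝓛_2^Gr(f/K)` (`IsGreenbergLFunctionAnyRoot₂`), both in the variables `(T₁′, T₂′) = (γ₁′ − 1, γ₂′ − 1)`.
A Type-valued record of tree predicates (no existence smuggled: frames are produced by W2).  VERBATIM the structure of
`Cruxes/OrdLambdaHalfAtTwo/Lines/xi_dominant_klingen_two.lean` §1. [cite: YanZhu2026, §3 (Katz / Greenberg frames)] -/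
structure XiDatum.GreenbergFrame (X : XiDatum W κ γ) {N : ℕ} (f : CuspForm (Gamma0 N) 2)
    (LK G : PowerSeries (PowerSeries (PadicComplexInt 2))) : Type where
  /-- complex period. -/
  Ω : ℂ
  /-- `δ = √(±d_K)`. -/
  δ : ℂ
  /-- `2`-adic period, a unit of `W`. -/
  Ωp : (unrIntegers 2)ˣ
  Ω_ne : Ω ≠ 0
  δ_sq : δ ^ 2 = (NumberField.discr X.K : ℂ) ∨ δ ^ 2 = -(NumberField.discr X.K : ℂ)
  katz : IsKatzMeasure₂ X.ι X.v X.vbar ∅ X.κ₁' X.κ₂' X.γ₁'⁻¹ X.γ₂'⁻¹ 1 Ω δ ((Ωp : unrIntegers 2) : ℂ_[2]) LK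
  greenberg : IsGreenbergLFunctionAnyRoot₂ X.ι X.v X.vbar X.κ₁' X.κ₂' X.γ₁'⁻¹ X.γ₂'⁻¹ f
    (NumberField.discr X.K).natAbs (NumberField.classNumber X.K) LK G

end Summit.BirchSwinnertonDyer.BirchSwinnertonDyer.Theorems.TwoAdicXiSupply

end
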